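import Literature.MathematicalPhysics.QuantumFieldTheory.Balaban1983to89.Beta.DecimatedMomentSummable

/-!
# `BalabanUV.Beta.FP.TransportLimit` — road «FP» for binder row D1, leaf N5 (first half): the STRANG–FIX COMB MOMENTS of a transport kernel
# (`DecimatedMomentSummable.ConstReproSum` = reproduction of constants, `LinReproSum` = reproduction of linear data) are CLOSED UNDER
# DOMINATED ENTRYWISE LIMITS — so the perfect (fixed-point) minimiser inherits affine reproduction from the finite-level minimisers
# (`KernelRepresentationSummable.lowMomentsSum_of_spec specK`, landed for every blocking) the moment the suppliers' convergence is in hand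

HONEST FRAMING (cell contract, verbatim): «discharging `BetaPertH` makes Bałaban's UV stability UNCONDITIONAL — a real constructive-QFT result;
it is NOT the continuum limit and NOT the Clay problem.»  THIS MODULE DISCHARGES NOTHING: Tannery's theorem (`tendsto_tsum_of_dominated_convergence`)
applied to the two comb-moment families.  Skeleton `HOME/beta/skeletons/D1-b2b-balaban-beta-d1-p3.md` leaf N5; claim table `HOME/b2b-balaban-beta-d1-p3/LEAVES-FP.md`.
NOT BetaPertH, NOT continuum, NOT Clay.
ABSOLUTE RULE (cell, verbatim): «No internally-minted statement may enter as a cited fact. Every hypothesis is either kernel-proved in this package or a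
verbatim quotation of a PUBLISHED theorem with page reference.»  Nothing is cited; `ConstReproSum`/`LinReproSum` are the cell's typed PREDICATES; every convergence
and domination statement is a HYPOTHESIS (supplier side: row G-an2-4 / X1m).

CONTENT: `hasSum_of_dominated_tendsto` (the generic step: `HasSum (F j) (s j)` for all `j`, `F j u → F∞ u`, `|F j u| ≤ g u` summable, `s j → s∞` ⇒ `HasSum F∞ s∞`),
`constReproSum_of_tendsto`, `linReproSum_of_tendsto` (the two Strang–Fix comb moments pass to dominated limits; the constants may move with `j`).
-/

namespace Summit.QuantumFields.BalabanUV.Beta.FP.TransportLimit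

open Filter Topology
open Literature.MathematicalPhysics.QuantumFieldTheory.Balaban1983to89.Beta
open DecimatedMoment (cosetInd)
open DecimatedMomentSummable (ConstReproSum LinReproSum)

variable {d : ℕ}

/-- [our object] **DOMINATED LIMITS OF SUMMED IDENTITIES** (Tannery): if `HasSum (F j) (s j)` for every `j`, `F j u → F∞ u` for every `u`, `|F j u| ≤ g u` with
`g` summable, and `s j → s∞`, then `HasSum F∞ s∞`. -/
theorem hasSum_of_dominated_tendsto {ι : Type*} {F : ℕ → ι → ℝ} {Finf : ι → ℝ} {s : ℕ → ℝ} {sinf : ℝ} {g : ι → ℝ}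
    (hg : Summable g) (hbound : ∀ j u, |F j u| ≤ g u) (hlim : ∀ u, Tendsto (fun j => F j u) atTop (𝓝 (Finf u)))
    (hsum : ∀ j, HasSum (F j) (s j)) (hs : Tendsto s atTop (𝓝 sinf)) : HasSum Finf sinf := by
  have hF : ∀ u, |Finf u| ≤ g u := fun u =>
    le_of_tendsto ((continuous_abs.tendsto _).comp (hlim u)) (Eventually.of_forall fun j => hbound j u)
  have hsFinf : Summable Finf :=
    (hg.of_nonneg_of_le (fun u => abs_nonneg _) hF).of_abs
  have htend : Tendsto (fun j => ∑' u, F j u) atTop (𝓝 (∑' u, Finf u)) :=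
    tendsto_tsum_of_dominated_convergence hg hlim (Eventually.of_forall fun j u => by
      rw [Real.norm_eq_abs]; exact hbound j u)
  have heq : (fun j => ∑' u, F j u) = s := funext fun j => (hsum j).tsum_eq
  rw [heq] at htend
  have : ∑' u, Finf u = sinf := tendsto_nhds_unique htend hs
  exact this ▸ hsFinf.hasSum

/-- [our object] The coset indicator is `0` or `1`. -/
theorem cosetInd_eq_zero_or_one (N : ℕ) (z : Fin d → ℤ) : cosetInd N z = 0 ∨ cosetInd N z = 1 := by
  unfold cosetInd; split_ifs <;> simp

/-- [our object] `|(cosetInd N z : ℝ)| ≤ 1`. -/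
theorem abs_cosetInd_le_one (N : ℕ) (z : Fin d → ℤ) : |((cosetInd N z : ℤ) : ℝ)| ≤ 1 := by
  rcases cosetInd_eq_zero_or_one N z with h | h <;> simp [h]

/-- [our object] **REPRODUCTION OF CONSTANTS PASSES TO DOMINATED LIMITS**: `ConstReproSum N (w j) (σ j)` for all `j`, `w j → w∞` entrywise under a summable majorant
`g`, `σ j → σ∞` ⇒ `ConstReproSum N w∞ σ∞`. -/
theorem constReproSum_of_tendsto {N : ℕ} {w : ℕ → (Fin d → ℤ) → ℝ} {winf : (Fin d → ℤ) → ℝ} {σ : ℕ → ℝ} {σinf : ℝ}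
    {g : (Fin d → ℤ) → ℝ} (hg : Summable g) (hbound : ∀ j u, |w j u| ≤ g u)
    (hlim : ∀ u, Tendsto (fun j => w j u) atTop (𝓝 (winf u))) (hrep : ∀ j, ConstReproSum N (w j) (σ j))
    (hσ : Tendsto σ atTop (𝓝 σinf)) : ConstReproSum N winf σinf := by
  intro a
  refine hasSum_of_dominated_tendsto (F := fun j u => cosetInd N (a - u) • w j u) (g := g) hg ?_ ?_ (fun j => hrep j a) hσ
  · intro j u
    rw [zsmul_eq_mul, abs_mul]
    calc |((cosetInd N (a - u) : ℤ) : ℝ)| * |w j u| ≤ 1 * g u :=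
          mul_le_mul (abs_cosetInd_le_one N (a - u)) (hbound j u) (abs_nonneg _) zero_le_one
      _ = g u := one_mul _
  · intro u
    simpa only [zsmul_eq_mul] using (hlim u).const_mul (((cosetInd N (a - u) : ℤ) : ℝ))

/-- [our object] **REPRODUCTION OF LINEAR DATA PASSES TO DOMINATED LIMITS**: `LinReproSum N (w j) (C j)` for all `j`, `w j → w∞` entrywise, first-moment majorant
`u ↦ |u κ| · g u` summable for every `κ`, `C j κ → C∞ κ` ⇒ `LinReproSum N w∞ C∞`. -/
theorem linReproSum_of_tendsto {N : ℕ} {w : ℕ → (Fin d → ℤ) → ℝ} {winf : (Fin d → ℤ) → ℝ} {C : ℕ → Fin d → ℝ} {Cinf : Fin d → ℝ}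
    {g : (Fin d → ℤ) → ℝ} (hg1 : ∀ κ, Summable fun u => |((u κ : ℤ) : ℝ)| * g u) (hbound : ∀ j u, |w j u| ≤ g u)
    (hlim : ∀ u, Tendsto (fun j => w j u) atTop (𝓝 (winf u))) (hrep : ∀ j, LinReproSum N (w j) (C j))
    (hC : ∀ κ, Tendsto (fun j => C j κ) atTop (𝓝 (Cinf κ))) : LinReproSum N winf Cinf := by
  intro a κ
  refine hasSum_of_dominated_tendsto (F := fun j u => (cosetInd N (a - u) * u κ) • w j u) (g := fun u => |((u κ : ℤ) : ℝ)| * g u)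
    (hg1 κ) ?_ ?_ (fun j => hrep j a κ) (hC κ)
  · intro j u
    rw [zsmul_eq_mul, abs_mul, Int.cast_mul, abs_mul]
    calc |((cosetInd N (a - u) : ℤ) : ℝ)| * |((u κ : ℤ) : ℝ)| * |w j u| ≤ 1 * |((u κ : ℤ) : ℝ)| * g u := by
          apply mul_le_mul (mul_le_mul_of_nonneg_right (abs_cosetInd_le_one N (a - u)) (abs_nonneg _)) (hbound j u) (abs_nonneg _)
          positivity
      _ = |((u κ : ℤ) : ℝ)| * g u := by ring
  · intro u
    simpa only [zsmul_eq_mul] using (hlim u).const_mul (((cosetInd N (a - u) * u κ : ℤ) : ℝ))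

end Summit.QuantumFields.BalabanUV.Beta.FP.TransportLimit
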